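import Literature.AlgebraicGeometry.Frobenioids.NumberFieldLocalizations
import HarnessLib

/-!
# Frobenioids II, Proposition 1.5 (v)–(ix): monomorphisms, FSM-morphisms, dissectibility, lifting

Mochizuki, *The geometry of Frobenioids II: poly-Frobenioids*, Kyushu J. Math. **62** (2008)
401–460, §1, Proposition 1.5 (v)–(ix), author's text pp. 14–15 [cite: MochizukiFrdII2008, Prop. 1.5 pp.14-15].
Sequel to `NumberFieldLocalizations.lean` ((i)–(iii)) and `NumberFieldLocalizationsAut.lean` ((iv)),
same conventions: `E = P ×_{P₀} E₀` for an abstract functor `π : E₀ ⥤ P₀` carrying the properties of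
Example 1.4 (ii) that each proof uses; the printed Proposition is the case of Example 1.4.

**Contents (one declaration per printed sub-item).**
* (v) mono / fiberwise-surjective / FSM iff the projection is — PROVED; (vi) PROVED;
* (vii) PROVED in the repaired form `dissectible_iff_fst` (extra hypothesis: non-initiality of an object
  of `E` is that of its projection), with the degenerate-case failure of the printed form recorded as an
  erratum candidate in its docstring (no named fact);
* (viii) typed as a named statement (with the Ex. 1.4 (ii) hypotheses its proof invokes);
* (ix) the factorisation-lifting PROVED under the abstract form `HasTrivialFactorizations P₀` of the
  hypothesis on `D_v` ("if `α ∘ β` is any composite morphism of `P₀` then either `α` or `β` is an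
  isomorphism", p. 15), the "irreducible or isomorphism" consequence PROVED, the totally-ordered
  consequence typed.

Nothing here is specific to number fields; nothing bears on [IUTchIII].
-/

namespace Literature.AlgebraicGeometry.Frobenioids

open CategoryTheory

universe v₀ v₁ v₂ u₀ u₁ u₂

namespace NFLoc

section FiberProduct

variable {P₀ : Type u₀} [Category.{v₀} P₀] {E₀ : Type u₁} [Category.{v₁} E₀]
  {P : Type u₂} [Category.{v₂} P] {F : P ⥤ P₀} {π : E₀ ⥤ P₀}

/-! ### (v) monomorphisms, fiberwise surjectivity, FSM-morphisms -/

/-- FrdII Prop. 1.5 (v), monomorphisms: `φ_E` is a monomorphism iff `φ_P` is.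
[cite: MochizukiFrdII2008, Prop. 1.5 (v) p.14] -/
theorem mono_iff_fst [π.Faithful] [π.EssSurj] (h : HomReconstruction π) {X Y : Loc F π}
    (φ : X ⟶ Y) : Mono φ ↔ Mono φ.fst := by
  constructor
  · intro hφ
    refine ⟨fun {A} b c hbc => ?_⟩
    obtain ⟨W, w, u, u', hw, hu, hu'⟩ := exists_lift₂ h X X b c
    haveI := hw
    have h1 : u ≫ φ = u' ≫ φ :=
      hom_eq_of_fst_eq (by simp only [CFP.comp_fst, hu, hu', Category.assoc, hbc])
    have h2 : u = u' := (cancel_mono φ).mp h1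
    have h3 : w ≫ b = w ≫ c := by rw [← hu, ← hu', h2]
    exact (cancel_epi w).mp h3
  · intro hφ
    refine ⟨fun g g' hgg' => hom_eq_of_fst_eq ((cancel_mono φ.fst).mp ?_)⟩
    have := congrArg CFP.Hom.fst hgg'
    simpa using this

/-- FrdII Prop. 1.5 (v), fiberwise surjectivity: `φ_E` is fiberwise surjective iff `φ_P` is.
[cite: MochizukiFrdII2008, Prop. 1.5 (v) p.14] -/
theorem isFiberwiseSurjective_iff_fst [π.Faithful] [π.EssSurj] (h : HomReconstruction π)
    {X Y : Loc F π} (φ : X ⟶ Y) : IsFiberwiseSurjective φ ↔ IsFiberwiseSurjective φ.fst := by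
  constructor
  · intro hφ A γ
    obtain ⟨W, w, u, -, hw, hu, -⟩ := exists_lift₂ h Y Y γ γ
    haveI := hw
    obtain ⟨D, δX, δW, hδ⟩ := hφ u
    refine ⟨D.fst, δX.fst, δW.fst ≫ w, ?_⟩
    have := congrArg CFP.Hom.fst hδ
    simp only [CFP.comp_fst, hu] at this
    rw [this, Category.assoc]
  · intro hφ Z γ
    obtain ⟨D, δB, δZ, hδ⟩ := hφ γ.fst
    obtain ⟨W, w, u, u', -, hu, hu'⟩ := exists_lift₂ h X Z δB δZ
    exact ⟨W, u, u', hom_eq_of_fst_eq (by simp only [CFP.comp_fst, hu, hu', Category.assoc, hδ])⟩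

/-- FrdII Prop. 1.5 (v), FSM-morphisms: `φ_E` is an FSM-morphism iff `φ_P` is.
[cite: MochizukiFrdII2008, Prop. 1.5 (v) p.14] -/
theorem isFSM_iff_fst [π.Faithful] [π.EssSurj] (h : HomReconstruction π) {X Y : Loc F π}
    (φ : X ⟶ Y) : IsFSM φ ↔ IsFSM φ.fst :=
  and_congr (isFiberwiseSurjective_iff_fst h φ) (mono_iff_fst h φ)

/-! ### (vi) `P`-isomorphisms versus FSM-morphisms -/

/-- FrdII Prop. 1.5 (vi): if `P` is of FSM-type, a morphism of `E` is a `P`-isomorphism iff it is an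
FSM-morphism. [cite: MochizukiFrdII2008, Prop. 1.5 (vi) p.14] -/
theorem isProjIso_iff_isFSM [π.Faithful] [π.EssSurj] (h : HomReconstruction π) (hP : IsOfFSMType P)
    {X Y : Loc F π} (φ : X ⟶ Y) : IsProjIso (toP F π) φ ↔ IsFSM φ := by
  rw [isFSM_iff_fst h, isProjIso_toP_iff]
  constructor
  · intro hφ
    exact ⟨fun A γ => ⟨A, γ ≫ inv φ.fst, 𝟙 A, by simp⟩, inferInstance⟩
  · intro hφ
    exact hP.isIso_of_isFSM φ.fst hφ

/-! ### (vii) dissectibility -/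

/-- Non-initiality is invariant under isomorphism. [cite: MochizukiFrdI2008, §0 p.15] -/
theorem isNonemptyObj_of_iso {C : Type u₂} [Category.{v₂} C] {A B : C} (e : A ≅ B)
    (hA : IsNonemptyObj A) : IsNonemptyObj B :=
  ⟨fun hB => hA.false (hB.ofIso e.symm)⟩

section Dissect

/-- FrdII Prop. 1.5 (vii), weak dissectibility, `E ⇒ P` (PROVED under the extra hypothesis `hne` that
non-initiality of an object of `E` is that of its projection; see `dissectible_iff_fst`).
[cite: MochizukiFrdII2008, Prop. 1.5 (vii) p.14] -/
theorem isWeaklyDissectible_fst [π.Faithful] [π.EssSurj] (h : HomReconstruction π)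
    (hne : ∀ Y : Loc F π, IsNonemptyObj Y ↔ IsNonemptyObj Y.fst) {X : Loc F π}
    (hX : IsWeaklyDissectible X) : IsWeaklyDissectible X.fst := by
  obtain ⟨Xs, φ, hnon, hdis⟩ := hX
  refine ⟨fun i => (Xs i).fst, fun i => (φ i).fst, fun i => (hne _).mp (hnon i), ?_⟩
  intro i j hij B hB ψi ψj heq
  obtain ⟨W, w, u, u', hw, hu, hu'⟩ := exists_lift₂ h (Xs i) (Xs j) ψi ψj
  haveI := hw
  have hW : IsNonemptyObj W := (hne W).mpr (isNonemptyObj_of_iso (asIso w).symm hB)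
  refine hdis hij hW u u' (hom_eq_of_fst_eq ?_)
  simp only [CFP.comp_fst, hu, hu', Category.assoc, heq]

/-- FrdII Prop. 1.5 (vii), weak dissectibility, `P ⇒ E` (PROVED under `hne`).
[cite: MochizukiFrdII2008, Prop. 1.5 (vii) p.14] -/
theorem isWeaklyDissectible_of_fst [π.EssSurj] (h : HomReconstruction π)
    (hne : ∀ Y : Loc F π, IsNonemptyObj Y ↔ IsNonemptyObj Y.fst) {X : Loc F π}
    (hX : IsWeaklyDissectible X.fst) : IsWeaklyDissectible X := by
  obtain ⟨Bs, φ, hnon, hdis⟩ := hX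
  have hl := fun i => exists_lift₂ h X X (φ i) (φ i)
  choose W w u u' hw hu hu' using hl
  refine ⟨W, u, fun i => ?_, ?_⟩
  · haveI := hw i
    exact (hne _).mpr (isNonemptyObj_of_iso (asIso (w i)).symm (hnon i))
  · intro i j hij B' hB' ψi ψj heq
    haveI := hw i; haveI := hw j
    have h1 := congrArg CFP.Hom.fst heq
    simp only [CFP.comp_fst, hu] at h1
    exact hdis hij ((hne B').mp hB') (ψi.fst ≫ w i) (ψj.fst ≫ w j) (by simpa using h1)

/-- FrdII Prop. 1.5 (vii), strong dissectibility, `E ⇒ P` (PROVED under `hne`).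
[cite: MochizukiFrdII2008, Prop. 1.5 (vii) p.14] -/
theorem isStronglyDissectible_fst [π.EssSurj] (h : HomReconstruction π)
    (hne : ∀ Y : Loc F π, IsNonemptyObj Y ↔ IsNonemptyObj Y.fst) {X : Loc F π}
    (hX : IsStronglyDissectible X) : IsStronglyDissectible X.fst := by
  obtain ⟨Xs, φ, hnon, hdis⟩ := hX
  refine ⟨fun i => (Xs i).fst, fun i => (φ i).fst, fun i => (hne _).mp (hnon i), ?_⟩
  rintro i j hij B hB ⟨⟨bi⟩, ⟨bj⟩⟩
  obtain ⟨W, w, u, u', hw, -, -⟩ := exists_lift₂ h (Xs i) (Xs j) bi bj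
  haveI := hw
  exact hdis hij ((hne W).mpr (isNonemptyObj_of_iso (asIso w).symm hB)) ⟨⟨u⟩, ⟨u'⟩⟩

/-- FrdII Prop. 1.5 (vii), strong dissectibility, `P ⇒ E` (PROVED under `hne`).
[cite: MochizukiFrdII2008, Prop. 1.5 (vii) p.14] -/
theorem isStronglyDissectible_of_fst [π.EssSurj] (h : HomReconstruction π)
    (hne : ∀ Y : Loc F π, IsNonemptyObj Y ↔ IsNonemptyObj Y.fst) {X : Loc F π}
    (hX : IsStronglyDissectible X.fst) : IsStronglyDissectible X := by
  obtain ⟨Bs, φ, hnon, hdis⟩ := hX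
  have hl := fun i => exists_lift₂ h X X (φ i) (φ i)
  choose W w u u' hw hu hu' using hl
  refine ⟨W, u, fun i => ?_, ?_⟩
  · haveI := hw i
    exact (hne _).mpr (isNonemptyObj_of_iso (asIso (w i)).symm (hnon i))
  · rintro i j hij B' hB' ⟨⟨ψi⟩, ⟨ψj⟩⟩
    exact hdis hij ((hne B').mp hB') ⟨⟨ψi.fst ≫ w i⟩, ⟨ψj.fst ≫ w j⟩⟩

/-- FrdII Prop. 1.5 (vii) (REPAIRED form, PROVED): for `A_E ∈ Ob(E)` with projection `A_P`, `A_P` is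
weakly dissectible (resp. weakly indissectible; strongly dissectible; strongly indissectible) iff `A_E`
is — under the Ex. 1.4 (ii) properties of `E₀ → P₀` AND the extra hypothesis `hne` that an object of
`E` is non-initial iff its projection is.  ERRATUM CANDIDATE (recorded neutrally, RULING P1): without
`hne` the printed statement fails in the degenerate case `D_v = 1` of Example 1.4 (`P₀` a one-morphism
category, whose object is initial, so nothing in `P₀` is "nonempty", while `E₀` — the poset of open
subgroups — has weakly dissectible objects, e.g. for `Gal(F̃/F) ≅ ℤ/2 × ℤ/2`, `v` totally split); an
abstract 4-element-poset model of the antecedents exhibits the same failure.  The printed (vii) is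
therefore not typed as a named fact. [cite: MochizukiFrdII2008, Prop. 1.5 (vii) p.14] -/
theorem dissectible_iff_fst [π.Faithful] [π.EssSurj] (h : HomReconstruction π)
    (hne : ∀ Y : Loc F π, IsNonemptyObj Y ↔ IsNonemptyObj Y.fst) (X : Loc F π) :
    (IsWeaklyDissectible X.fst ↔ IsWeaklyDissectible X) ∧
    (IsWeaklyIndissectible X.fst ↔ IsWeaklyIndissectible X) ∧
    (IsStronglyDissectible X.fst ↔ IsStronglyDissectible X) ∧
    (IsStronglyIndissectible X.fst ↔ IsStronglyIndissectible X) := by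
  have hw : IsWeaklyDissectible X.fst ↔ IsWeaklyDissectible X :=
    ⟨isWeaklyDissectible_of_fst h hne, isWeaklyDissectible_fst h hne⟩
  have hs : IsStronglyDissectible X.fst ↔ IsStronglyDissectible X :=
    ⟨isStronglyDissectible_of_fst h hne, isStronglyDissectible_fst h hne⟩
  exact ⟨hw, not_congr hs, hs, not_congr hw⟩

end Dissect

/-! ### (viii) FSMFF-type (named statement) -/

variable (F π) in
/-- FrdII Prop. 1.5 (viii), AS PRINTED (named statement, not asserted): if `P` is of FSM-type and
totally epimorphic then `E` is of FSMFF-type — under the Ex. 1.4 (ii) properties of `E₀ → P₀` the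
printed proof uses (`E₀` of FSMFF-type, `P₀` totally epimorphic, faithfulness, (i), (vi)).
[cite: MochizukiFrdII2008, Prop. 1.5 (viii) p.14] -/
def FSMFFOfFSMType : Prop :=
  π.Faithful → π.EssSurj → HomReconstruction π → IsTotallyEpimorphic P₀ → IsOfFSMFFType E₀ →
    IsOfFSMType P → IsTotallyEpimorphic P → IsOfFSMFFType (Loc F π)

/-! ### (ix) lifting factorisations -/

variable (P₀) in
/-- The abstract form of the hypothesis of FrdII Prop. 1.5 (ix) on `D_v` ("a finite group which is
either trivial or of prime order"), namely the consequence the proof uses (p. 15): "if `α ∘ β` is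
any composite morphism of `P₀`, then either `α` or `β` is an isomorphism".
[cite: MochizukiFrdII2008, Prop. 1.5 (ix) p.15] -/
@[mk_iff] structure HasTrivialFactorizations : Prop where
  /-- one factor of every composable pair is an isomorphism -/
  isIso_or : ∀ {A M B : P₀} (β : A ⟶ M) (α : M ⟶ B), IsIso α ∨ IsIso β

/-- FrdII Prop. 1.5 (ix), the factorisation clause: if in `P₀` one factor of every composite is an
isomorphism, then every factorisation `φ_P = α_P ∘ β_P` in `P` lifts to a factorisation
`φ_E = α_E ∘ β_E` in `E` (the middle object of `E` lies over the printed middle object, and the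
lifts have `P`-components literally `α_P`, `β_P`). [cite: MochizukiFrdII2008, Prop. 1.5 (ix) p.14] -/
theorem exists_lift_factorization (hP₀ : HasTrivialFactorizations P₀) {X Y : Loc F π} (φ : X ⟶ Y)
    {M : P} (β : X.fst ⟶ M) (α : M ⟶ Y.fst) (hφ : β ≫ α = φ.fst) :
    ∃ (X₂ : E₀) (γ : F.obj M ≅ π.obj X₂) (βE : X ⟶ CFP.mk M X₂ γ) (αE : CFP.mk M X₂ γ ⟶ Y),
      βE ≫ αE = φ ∧ βE.fst = β ∧ αE.fst = α := by
  rcases hP₀.isIso_or (X.iso.inv ≫ F.map β) (F.map α ≫ Y.iso.hom) with hα | hβ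
  · -- `F α` is an isomorphism: put the middle object over `Y.snd`
    haveI := hα
    refine ⟨Y.snd, asIso (F.map α ≫ Y.iso.hom), ⟨β, φ.snd, ?_⟩, ⟨α, 𝟙 _, by simp⟩, ?_, rfl, rfl⟩
    · rw [map_snd_eq, ← hφ, F.map_comp]
      simp
    · exact CFP.hom_ext hφ (by simp)
  · -- `F β` is an isomorphism: put the middle object over `X.snd`
    haveI := hβ
    refine ⟨X.snd, (asIso (X.iso.inv ≫ F.map β)).symm, ⟨β, 𝟙 _, ?_⟩, ⟨α, φ.snd, ?_⟩, ?_, rfl, rfl⟩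
    · simp only [Iso.symm_hom, asIso_inv]
      rw [IsIso.comp_inv_eq]
      simp
    · simp only [Iso.symm_hom, asIso_inv]
      rw [IsIso.eq_inv_comp, map_snd_eq, ← hφ, F.map_comp]
      simp only [Category.assoc]
    · exact CFP.hom_ext hφ (by simp)

/-- FrdII Prop. 1.5 (ix), "in particular" (irreducibility clause): if `φ_E` is either irreducible
or an isomorphism, then so is `φ_P`. [cite: MochizukiFrdII2008, Prop. 1.5 (ix) p.14] -/
theorem isIrreducibleHom_or_isIso_fst (hP₀ : HasTrivialFactorizations P₀) {X Y : Loc F π}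
    (φ : X ⟶ Y) (hφ : IsIrreducibleHom φ ∨ IsIso φ) : IsIrreducibleHom φ.fst ∨ IsIso φ.fst := by
  by_cases hiso : IsIso φ.fst
  · exact Or.inr hiso
  · refine Or.inl ⟨hiso, fun M β α hβα => ?_⟩
    obtain ⟨X₂, γ, βE, αE, hcomp, hβ, hα⟩ := exists_lift_factorization hP₀ φ β α hβα
    rcases hφ with hirr | hφiso
    · rcases hirr.2 βE αE hcomp with hαE | hβE
      · left
        haveI := hαE
        rw [← hα]
        exact (inferInstance : IsIso ((toP F π).map αE))
      · right
        haveI := hβE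
        rw [← hβ]
        exact (inferInstance : IsIso ((toP F π).map βE))
    · exfalso
      haveI := hφiso
      exact hiso (inferInstance : IsIso ((toP F π).map φ))

variable (F π) in
/-- FrdII Prop. 1.5 (ix), "in particular" (totally ordered clause), AS PRINTED (named statement,
not asserted): under the hypothesis on `D_v`, if `φ_E` is totally ordered [§0] then so is `φ_P`
(the proof combines the factorisation clause with the monomorphism clause of (v)).
[cite: MochizukiFrdII2008, Prop. 1.5 (ix) p.14] -/
def TotallyOrderedDescends : Prop :=
  HasTrivialFactorizations P₀ → π.Faithful → π.EssSurj → HomReconstruction π →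
    ∀ {X Y : Loc F π} (φ : X ⟶ Y), IsTotallyOrderedHom φ → IsTotallyOrderedHom φ.fst

end FiberProduct

end NFLoc

end Literature.AlgebraicGeometry.Frobenioids
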